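import Summits.Ventures.YMGap.Thresholds.OneLinkSecondMoments
import Summits.Ventures.YMGap.Thresholds.OneLinkSDMeans
import Summits.Ventures.YMGap.Thresholds.OneLinkFeedback
import HarnessLib

/-!
# Venture YMGap — the one-link modulus beyond first order, part 17: the SECOND-ORDER Schwinger–Dyson mean bound and the
# resulting second moment of the complex linear statistic under `ν_B`

HONEST FRAMING: venture file of the cell `pub-ymgap` (QuantumFields programme), strong-coupling LATTICE bookkeeping for `SU(N)`
lattice Yang–Mills; nothing about the continuum or the mass gap in the Clay sense.  No number of record («F4.3b», primitive `m₁`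
of the cell note `HOME/p2/ONE-LINK-HIERARCHY.md` §4 (4.2)).

WHAT.  `ν_B(dg) ∝ exp(N Re tr(gB)) dg`, `N ≥ 2`, `‖B‖_op = r < 1/2`, `ρ = N(1/2 − r)`, `D = N/(N − 1/N)`, `A_M = ‖E_ν tr(gM)‖`
(`= √((E Re tr gM)² + (E Im tr gM)²)`).  The first-order Schwinger–Dyson bound of the tree (`norm_mean_trace_le`) is
`A_M ≤ D·2√N r‖M‖_F`; it bounds the trace–trace term `(1/N) E[Im tr(Bg) Im tr(Mg)]` pointwise.  Here that term is split into a
covariance (two Poincaré inequalities, `OneLinkFluctuations`) and a product of means, which feeds back: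
* `abs_mean_re_trace_le_two`: `|E Re tr(gM)| ≤ D(‖B‖_F‖M‖_F(1 + 1/(Nρ)) + (D·2√N r‖B‖_F)·A_M/N)`;
* `norm_mean_trace_le_two` (rotation trick + absorption): `A_M ≤ D‖B‖_F‖M‖_F(1 + 1/(Nρ)) / (1 − 2D²r²)`;
* `sqrt_integral_normSq_trace_le_two`: `√(∫‖tr(gM)‖² dν_B) ≤ D‖B‖_F‖M‖_F(1 + 1/(Nρ))/(1 − 2D²r²) + ‖M‖_F/√ρ`.
With `‖B‖_F ≤ √N r` the mean coefficient drops from `2D ≈ 2` to `≈ D(1+1/(Nρ))/(1−2D²r²) ≈ 1.14` at `(N, r) = (10, 0.2)`: the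
«second-order `m₁`» column of the cell note (refined level-two rows in the next files).

References: cell note `HOME/p2/ONE-LINK-HIERARCHY.md` §4 (4.2); Shen–Zhu–Zhu CMP 400 (2023) §4.1.
-/

noncomputable section

open scoped Matrix ComplexConjugate BigOperators ContDiff Matrix.Norms.Frobenius
open Matrix Complex Finset MeasureTheory ProbabilityTheory
open Literature.MathematicalPhysics.QuantumFieldTheory
open Literature.MathematicalPhysics.QuantumFieldTheory.SUNBakryEmery

namespace Summit.Ventures.YMGap.OneLinkEigen

variable {N : ℕ}

/-- `|b| ≤ √(a² + b²)`. [folklore] -/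
theorem abs_le_sqrt_sq_add_sq' (a b : ℝ) : |b| ≤ Real.sqrt (a ^ 2 + b ^ 2) :=
  Real.abs_le_sqrt (by nlinarith [sq_nonneg a])

/-- **Second-order Schwinger–Dyson inequality for the real mean.**  With `A_M = √((E Re tr gM)² + (E Im tr gM)²)`:
`|E_ν Re tr(gM)| ≤ D (‖B‖_F ‖M‖_F (1 + 1/(Nρ)) + (D·2√N‖B‖_op‖B‖_F) · A_M / N)`, `D = N/(N − 1/N)`, `ρ = N(1/2 − ‖B‖_op)`.
[folklore] -/
theorem abs_mean_re_trace_le_two (hN : 2 ≤ N) {B : Matrix (Fin N) (Fin N) ℂ} (hB : matrixOpNorm B < 1 / 2)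
    (M : Matrix (Fin N) (Fin N) ℂ) :
    |∫ g, ((g : Matrix (Fin N) (Fin N) ℂ) * M).trace.re
        ∂(haarProbability (SUN N)).tilted (fun g => (N : ℝ) * ((g : Matrix (Fin N) (Fin N) ℂ) * B).trace.re)| ≤
      (N : ℝ) / ((N : ℝ) - 1 / N) *
        (frobNorm B * frobNorm M * (1 + 1 / ((N : ℝ) * ((N : ℝ) * (1 / 2 - matrixOpNorm B))))
          + (N : ℝ) / ((N : ℝ) - 1 / N) * (2 * Real.sqrt N * matrixOpNorm B * frobNorm B) *
            Real.sqrt ((∫ g, ((g : Matrix (Fin N) (Fin N) ℂ) * M).trace.re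
                ∂(haarProbability (SUN N)).tilted (fun g => (N : ℝ) * ((g : Matrix (Fin N) (Fin N) ℂ) * B).trace.re)) ^ 2
              + (∫ g, ((g : Matrix (Fin N) (Fin N) ℂ) * M).trace.im
                ∂(haarProbability (SUN N)).tilted (fun g => (N : ℝ) * ((g : Matrix (Fin N) (Fin N) ℂ) * B).trace.re)) ^ 2) / N) := by
  have hN0 : N ≠ 0 := by omega
  have hNpos : (0 : ℝ) < N := Nat.cast_pos.2 (Nat.pos_of_ne_zero hN0)
  have hN2 : (2 : ℝ) ≤ N := by exact_mod_cast hN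
  set r : ℝ := matrixOpNorm B with hr
  have hr0 : 0 ≤ r := matrixOpNorm_nonneg B
  set ρ : ℝ := (N : ℝ) * (1 / 2 - r) with hρdef
  have hρ : 0 < ρ := mul_pos hNpos (by linarith)
  have hB0 := frobNorm_nonneg B
  have hM0 := frobNorm_nonneg M
  set lam : ℝ := (N : ℝ) - 1 / N with hlam
  have hlampos : 0 < lam := by
    have : (1 : ℝ) / N ≤ 1 / 2 := by rw [div_le_div_iff₀ hNpos (by norm_num)]; linarith
    rw [hlam]; linarith
  set D : ℝ := (N : ℝ) / lam with hD
  have hD0 : 0 ≤ D := (div_pos hNpos hlampos).le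
  set ν : Measure (SUN N) :=
    (haarProbability (SUN N)).tilted (fun g => (N : ℝ) * ((g : Matrix (Fin N) (Fin N) ℂ) * B).trace.re) with hν
  have hexpi : Integrable (fun g : SUN N => Real.exp ((N : ℝ) * ((g : Matrix (Fin N) (Fin N) ℂ) * B).trace.re))
      (haarProbability (SUN N)) :=
    integrable_of_continuous_SUN (Real.continuous_exp.comp (continuous_restrict (contDiff_pot (N : ℝ) B))) _
  haveI : IsProbabilityMeasure ν := isProbabilityMeasure_tilted hexpi
  -- the observables
  set X : SUN N → ℝ := fun g => ((g : Matrix (Fin N) (Fin N) ℂ) * B).trace.im with hX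
  set Y : SUN N → ℝ := fun g => ((g : Matrix (Fin N) (Fin N) ℂ) * M).trace.im with hY
  set aM : ℝ := ∫ g, ((g : Matrix (Fin N) (Fin N) ℂ) * M).trace.re ∂ν with haM
  set bM : ℝ := ∫ g, Y g ∂ν with hbM
  set AM : ℝ := Real.sqrt (aM ^ 2 + bM ^ 2) with hAM
  have hXc : Continuous X := (continuous_restrict (N := N) (contDiff_pot 1 ((-I) • B))).congr
    (fun g => by simp only [pot, one_mul, re_trace_mul_negI_smul, hX])
  have hYc : Continuous Y := (continuous_restrict (N := N) (contDiff_pot 1 ((-I) • M))).congr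
    (fun g => by simp only [pot, one_mul, re_trace_mul_negI_smul, hY])
  have mX : MemLp X 2 ν := memLp_two_of_continuous hXc ν
  have mY : MemLp Y 2 ν := memLp_two_of_continuous hYc ν
  -- (1) the Schwinger–Dyson identity `λ₁ aM = N ∫ Γ(pot B, pot M)`
  have hid := integral_pot_eq hN0 B M (N := N)
  rw [← hν] at hid
  -- (2) the closed form of `Γ(pot B, pot M)` on `SU(N)`, integrated
  have hGam : ∀ g : SUN N, Gam (pot 1 B) (pot 1 M) g =
      -(1 / 2) * (B * (g : Matrix (Fin N) (Fin N) ℂ) * M * (g : Matrix (Fin N) (Fin N) ℂ)).trace.re + (1 / 2) * (B * Mᴴ).trace.re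
        - (1 / N) * (X g * Y g) := by
    intro g
    rw [Gam_potB_pot_one hN0, hX, hY, trace_mul_comm B (g : Matrix (Fin N) (Fin N) ℂ), trace_mul_comm M (g : Matrix (Fin N) (Fin N) ℂ)]
    ring
  have hwc : Continuous fun g : SUN N => (B * (g : Matrix (Fin N) (Fin N) ℂ) * M * (g : Matrix (Fin N) (Fin N) ℂ)).trace.re := by
    have h := continuous_restrict (N := N) (contDiff_reTrQuad M B)
    refine (Complex.continuous_re.comp ((((continuous_const.matrix_mul continuous_subtype_val).matrix_mul
      continuous_const).matrix_mul continuous_subtype_val).matrix_trace))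
  have iw : Integrable (fun g : SUN N => (B * (g : Matrix (Fin N) (Fin N) ℂ) * M * (g : Matrix (Fin N) (Fin N) ℂ)).trace.re) ν :=
    integrable_of_continuous_SUN hwc ν
  have iXY : Integrable (fun g : SUN N => X g * Y g) ν := integrable_of_continuous_SUN (hXc.mul hYc) ν
  have hsplit : ∫ g, Gam (pot 1 B) (pot 1 M) g ∂ν =
      -(1 / 2) * ∫ g, (B * (g : Matrix (Fin N) (Fin N) ℂ) * M * (g : Matrix (Fin N) (Fin N) ℂ)).trace.re ∂ν
        + (1 / 2) * (B * Mᴴ).trace.re - (1 / N) * ∫ g, X g * Y g ∂ν := by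
    simp_rw [hGam]
    have i1 : Integrable (fun g : SUN N => -(1 / 2) * (B * (g : Matrix (Fin N) (Fin N) ℂ) * M * (g : Matrix (Fin N) (Fin N) ℂ)).trace.re) ν :=
      iw.const_mul _
    have i2 : Integrable (fun _ : SUN N => (1 / 2) * (B * Mᴴ).trace.re) ν := integrable_const _
    have i3 : Integrable (fun g : SUN N => (1 / N) * (X g * Y g)) ν := iXY.const_mul _
    have i12 : Integrable (fun g : SUN N =>
        -(1 / 2) * (B * (g : Matrix (Fin N) (Fin N) ℂ) * M * (g : Matrix (Fin N) (Fin N) ℂ)).trace.re + (1 / 2) * (B * Mᴴ).trace.re) ν :=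
      i1.add i2
    rw [integral_sub i12 i3, integral_add i1 i2, integral_const_mul, integral_const_mul, integral_const_mul, integral_const]
    simp
  -- (3) the three pieces
  have p1 : |∫ g, (B * (g : Matrix (Fin N) (Fin N) ℂ) * M * (g : Matrix (Fin N) (Fin N) ℂ)).trace.re ∂ν| ≤ frobNorm B * frobNorm M := by
    refine (abs_integral_le_integral_abs).trans ?_
    calc ∫ g, |(B * (g : Matrix (Fin N) (Fin N) ℂ) * M * (g : Matrix (Fin N) (Fin N) ℂ)).trace.re| ∂ν
        ≤ ∫ g, frobNorm B * frobNorm M ∂ν := by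
          refine integral_mono iw.abs (integrable_const _) fun g => ?_
          have hg := SUN.mem_unitaryGroup g
          rw [Matrix.mul_assoc (B * (g : Matrix (Fin N) (Fin N) ℂ))]
          refine (abs_re_trace_mul_le _ _).trans ?_
          rw [frobNorm_mul_unitary _ hg, frobNorm_mul_unitary _ hg]
      _ = frobNorm B * frobNorm M := by simp
  have p2 : |(B * Mᴴ).trace.re| ≤ frobNorm B * frobNorm M := by
    refine (abs_re_trace_mul_le _ _).trans ?_; rw [frobNorm_conjTranspose]
  -- the trace–trace term: covariance + product of means
  have hXY : ∫ g, X g * Y g ∂ν = cov[X, Y; ν] + (∫ g, X g ∂ν) * ∫ g, Y g ∂ν := by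
    rw [covariance_eq_sub mX mY]; simp only [Pi.mul_apply]; ring
  have hvarX : Var[X; ν] ≤ frobNorm B ^ 2 / ρ := by
    have h := variance_re_add_variance_im_le hN0 hB B (N := N)
    rw [← hν] at h
    have h0 := variance_nonneg (fun g : SUN N => ((g : Matrix (Fin N) (Fin N) ℂ) * B).trace.re) ν
    rw [hX, hρdef, hr]
    linarith
  have hvarY : Var[Y; ν] ≤ frobNorm M ^ 2 / ρ := by
    have h := variance_re_add_variance_im_le hN0 hB M (N := N)
    rw [← hν] at h
    have h0 := variance_nonneg (fun g : SUN N => ((g : Matrix (Fin N) (Fin N) ℂ) * M).trace.re) ν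
    rw [hY, hρdef, hr]
    linarith
  have hcov : |cov[X, Y; ν]| ≤ frobNorm B * frobNorm M / ρ := by
    have hcs : |cov[X, Y; ν]| ≤ Real.sqrt (Var[X; ν] * Var[Y; ν]) := by
      rw [← Real.sqrt_sq_eq_abs]; exact Real.sqrt_le_sqrt (cov_sq_le_var_mul_var mX mY)
    refine hcs.trans ?_
    calc Real.sqrt (Var[X; ν] * Var[Y; ν]) ≤ Real.sqrt ((frobNorm B ^ 2 / ρ) * (frobNorm M ^ 2 / ρ)) :=
          Real.sqrt_le_sqrt (mul_le_mul hvarX hvarY (variance_nonneg _ _) (div_nonneg (sq_nonneg _) hρ.le))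
      _ = frobNorm B * frobNorm M / ρ := by
          rw [show frobNorm B ^ 2 / ρ * (frobNorm M ^ 2 / ρ) = (frobNorm B * frobNorm M / ρ) ^ 2 by field_simp]
          exact Real.sqrt_sq (div_nonneg (mul_nonneg hB0 hM0) hρ.le)
  have hEX : |∫ g, X g ∂ν| ≤ D * (2 * Real.sqrt N * r * frobNorm B) := by
    have h := norm_mean_trace_le hN B B
    rw [← hν] at h
    exact (abs_le_sqrt_sq_add_sq' _ _).trans h
  have hEY : |∫ g, Y g ∂ν| ≤ AM := abs_le_sqrt_sq_add_sq' _ _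
  have p3 : |∫ g, X g * Y g ∂ν| ≤ frobNorm B * frobNorm M / ρ + D * (2 * Real.sqrt N * r * frobNorm B) * AM := by
    rw [hXY]
    refine (abs_add_le _ _).trans (add_le_add hcov ?_)
    rw [abs_mul]
    exact mul_le_mul hEX hEY (abs_nonneg _) (by positivity)
  -- (4) assemble
  have haMeq : aM = D * ∫ g, Gam (pot 1 B) (pot 1 M) g ∂ν := by
    rw [hD, div_mul_eq_mul_div, eq_div_iff hlampos.ne']
    linarith [hid]
  rw [haMeq, hsplit, abs_mul, abs_of_nonneg hD0]
  refine mul_le_mul_of_nonneg_left ?_ hD0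
  have hB0 := frobNorm_nonneg B
  have hM0 := frobNorm_nonneg M
  calc |-(1 / 2) * ∫ g, (B * (g : Matrix (Fin N) (Fin N) ℂ) * M * (g : Matrix (Fin N) (Fin N) ℂ)).trace.re ∂ν
          + (1 / 2) * (B * Mᴴ).trace.re - (1 / N) * ∫ g, X g * Y g ∂ν|
      ≤ |-(1 / 2) * ∫ g, (B * (g : Matrix (Fin N) (Fin N) ℂ) * M * (g : Matrix (Fin N) (Fin N) ℂ)).trace.re ∂ν|
          + |(1 / 2) * (B * Mᴴ).trace.re| + |(1 / N) * ∫ g, X g * Y g ∂ν| :=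
        (abs_sub _ _).trans (add_le_add (abs_add_le _ _) le_rfl)
    _ ≤ 1 / 2 * (frobNorm B * frobNorm M) + 1 / 2 * (frobNorm B * frobNorm M)
          + 1 / N * (frobNorm B * frobNorm M / ρ + D * (2 * Real.sqrt N * r * frobNorm B) * AM) := by
        rw [abs_mul, abs_mul, abs_mul, abs_neg, abs_of_pos (by norm_num : (0 : ℝ) < 1 / 2),
          abs_of_pos (by positivity : (0 : ℝ) < 1 / N)]
        exact add_le_add (add_le_add (mul_le_mul_of_nonneg_left p1 (by norm_num))
          (mul_le_mul_of_nonneg_left p2 (by norm_num))) (mul_le_mul_of_nonneg_left p3 (by positivity))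
    _ = _ := by
        rw [hρdef]
        field_simp
        ring

/-- **The second-order Schwinger–Dyson mean bound**: with `D = N/(N − 1/N)`, `ρ = N(1/2 − ‖B‖_op)`,
`√((E Re tr gM)² + (E Im tr gM)²) ≤ D ‖B‖_F ‖M‖_F (1 + 1/(Nρ)) / (1 − 2D²‖B‖_op²)`. [folklore] -/
theorem norm_mean_trace_le_two (hN : 2 ≤ N) {B : Matrix (Fin N) (Fin N) ℂ} (hB : matrixOpNorm B < 1 / 2)
    (M : Matrix (Fin N) (Fin N) ℂ) :
    Real.sqrt ((∫ g, ((g : Matrix (Fin N) (Fin N) ℂ) * M).trace.re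
          ∂(haarProbability (SUN N)).tilted (fun g => (N : ℝ) * ((g : Matrix (Fin N) (Fin N) ℂ) * B).trace.re)) ^ 2
        + (∫ g, ((g : Matrix (Fin N) (Fin N) ℂ) * M).trace.im
          ∂(haarProbability (SUN N)).tilted (fun g => (N : ℝ) * ((g : Matrix (Fin N) (Fin N) ℂ) * B).trace.re)) ^ 2) ≤
      (N : ℝ) / ((N : ℝ) - 1 / N) * frobNorm B * frobNorm M * (1 + 1 / ((N : ℝ) * ((N : ℝ) * (1 / 2 - matrixOpNorm B))))
        / (1 - 2 * ((N : ℝ) / ((N : ℝ) - 1 / N)) ^ 2 * matrixOpNorm B ^ 2) := by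
  have hN0 : N ≠ 0 := by omega
  have hNpos : (0 : ℝ) < N := Nat.cast_pos.2 (Nat.pos_of_ne_zero hN0)
  have hN2 : (2 : ℝ) ≤ N := by exact_mod_cast hN
  set r : ℝ := matrixOpNorm B with hr
  have hr0 : 0 ≤ r := matrixOpNorm_nonneg B
  have hB0 := frobNorm_nonneg B
  have hM0 := frobNorm_nonneg M
  set lam : ℝ := (N : ℝ) - 1 / N with hlam
  have hlam34 : 3 / 4 * (N : ℝ) ≤ lam := by
    have : (1 : ℝ) / N ≤ (N : ℝ) / 4 := by rw [div_le_div_iff₀ hNpos (by norm_num)]; nlinarith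
    rw [hlam]; linarith
  have hlampos : 0 < lam := by linarith
  set D : ℝ := (N : ℝ) / lam with hD
  have hD0 : 0 ≤ D := (div_pos hNpos hlampos).le
  have hD43 : D ≤ 4 / 3 := by
    rw [hD, div_le_iff₀ hlampos]; linarith
  have hden : 0 < 1 - 2 * D ^ 2 * r ^ 2 := by
    have h1 : D ^ 2 ≤ (4 / 3) ^ 2 := pow_le_pow_left₀ hD0 hD43 2
    have h2 : r ^ 2 < (1 / 2) ^ 2 := pow_lt_pow_left₀ hB hr0 (by norm_num)
    nlinarith [sq_nonneg D, sq_nonneg r, mul_nonneg (sub_nonneg.2 h1) (sq_nonneg r)]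
  set ν : Measure (SUN N) :=
    (haarProbability (SUN N)).tilted (fun g => (N : ℝ) * ((g : Matrix (Fin N) (Fin N) ℂ) * B).trace.re) with hν
  have hexpi : Integrable (fun g : SUN N => Real.exp ((N : ℝ) * ((g : Matrix (Fin N) (Fin N) ℂ) * B).trace.re))
      (haarProbability (SUN N)) :=
    integrable_of_continuous_SUN (Real.continuous_exp.comp (continuous_restrict (contDiff_pot (N : ℝ) B))) _
  haveI : IsProbabilityMeasure ν := isProbabilityMeasure_tilted hexpi
  set a : ℝ := ∫ g, ((g : Matrix (Fin N) (Fin N) ℂ) * M).trace.re ∂ν with ha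
  set b : ℝ := ∫ g, ((g : Matrix (Fin N) (Fin N) ℂ) * M).trace.im ∂ν with hb
  set s : ℝ := Real.sqrt (a ^ 2 + b ^ 2) with hs
  have hs0 : 0 ≤ s := Real.sqrt_nonneg _
  set Φ : ℝ := frobNorm B * (1 + 1 / ((N : ℝ) * ((N : ℝ) * (1 / 2 - r)))) with hΦ
  have hΦ0 : 0 ≤ Φ := by
    have : 0 < 1 / 2 - r := by linarith
    rw [hΦ]
    positivity
  -- the rotated matrix `c • M`, `c = a - i b`
  set c : ℂ := (a : ℂ) - (b : ℂ) * I with hc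
  have hcn : ‖c‖ = s := by
    rw [hc, Complex.norm_def, Complex.normSq_apply, hs]
    congr 1
    simp [sq]
  have hre : ∀ g : SUN N, ((g : Matrix (Fin N) (Fin N) ℂ) * (c • M)).trace.re =
      a * ((g : Matrix (Fin N) (Fin N) ℂ) * M).trace.re + b * ((g : Matrix (Fin N) (Fin N) ℂ) * M).trace.im := by
    intro g
    rw [Matrix.mul_smul, trace_smul, smul_eq_mul, hc, mul_re, sub_re, sub_im, ofReal_re, ofReal_im, mul_re, mul_im,
      ofReal_re, ofReal_im, I_re, I_im]
    ring
  have him : ∀ g : SUN N, ((g : Matrix (Fin N) (Fin N) ℂ) * (c • M)).trace.im =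
      a * ((g : Matrix (Fin N) (Fin N) ℂ) * M).trace.im - b * ((g : Matrix (Fin N) (Fin N) ℂ) * M).trace.re := by
    intro g
    rw [Matrix.mul_smul, trace_smul, smul_eq_mul, hc, mul_im, sub_re, sub_im, ofReal_re, ofReal_im, mul_re, mul_im,
      ofReal_re, ofReal_im, I_re, I_im]
    ring
  have ire : Integrable (fun g : SUN N => ((g : Matrix (Fin N) (Fin N) ℂ) * M).trace.re) ν :=
    integrable_of_continuous_SUN (continuous_re_trace_su_mul M) ν
  have iim : Integrable (fun g : SUN N => ((g : Matrix (Fin N) (Fin N) ℂ) * M).trace.im) ν :=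
    integrable_of_continuous_SUN (continuous_restrict (N := N) (contDiff_pot 1 ((-I) • M)) |>.congr
      (fun g => by simp only [pot, one_mul, re_trace_mul_negI_smul])) ν
  have hmean_re : ∫ g, ((g : Matrix (Fin N) (Fin N) ℂ) * (c • M)).trace.re ∂ν = a * a + b * b := by
    simp_rw [hre]
    rw [integral_add (ire.const_mul a) (iim.const_mul b), integral_const_mul, integral_const_mul, ← ha, ← hb]
  have hmean_im : ∫ g, ((g : Matrix (Fin N) (Fin N) ℂ) * (c • M)).trace.im ∂ν = 0 := by
    simp_rw [him]
    rw [integral_sub (iim.const_mul a) (ire.const_mul b), integral_const_mul, integral_const_mul, ← ha, ← hb]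
    ring
  -- the second-order inequality for `c • M`
  have h := abs_mean_re_trace_le_two hN hB (c • M)
  rw [← hν, hmean_re, hmean_im, frobNorm_smul, hcn] at h
  have hss : a * a + b * b = s * s := by rw [hs, Real.mul_self_sqrt (by positivity)]; ring
  have hsq0 : Real.sqrt ((s * s) ^ 2 + (0 : ℝ) ^ 2) = s * s := by
    rw [zero_pow two_ne_zero, add_zero, Real.sqrt_sq (mul_nonneg hs0 hs0)]
  rw [hss, abs_of_nonneg (mul_nonneg hs0 hs0), hsq0] at h
  -- `h : s·s ≤ D (‖B‖_F (s‖M‖_F)(1 + 1/(Nρ)) + D(2√N r‖B‖_F)·(s s)/N)`; absorb the last term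
  have hAB : (N : ℝ) / ((N : ℝ) - 1 / N) * (2 * Real.sqrt N * r * frobNorm B) / N ≤ 2 * D * r ^ 2 := by
    have hBF : frobNorm B ≤ Real.sqrt N * r := frobNorm_le_sqrt_mul_matrixOpNorm B
    rw [← hlam, ← hD, div_le_iff₀ hNpos]
    have hsN : Real.sqrt N * Real.sqrt N = N := Real.mul_self_sqrt hNpos.le
    have : D * (2 * Real.sqrt N * r * frobNorm B) ≤ D * (2 * Real.sqrt N * r * (Real.sqrt N * r)) :=
      mul_le_mul_of_nonneg_left (mul_le_mul_of_nonneg_left hBF (by positivity)) hD0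
    calc _ ≤ D * (2 * Real.sqrt N * r * (Real.sqrt N * r)) := this
      _ = 2 * D * r ^ 2 * (Real.sqrt N * Real.sqrt N) := by ring
      _ = 2 * D * r ^ 2 * N := by rw [hsN]
  have hkey : s * (1 - 2 * D ^ 2 * r ^ 2) ≤ D * frobNorm M * Φ := by
    by_cases hs00 : s = 0
    · rw [hs00, zero_mul]; exact mul_nonneg (mul_nonneg hD0 (frobNorm_nonneg M)) hΦ0
    · have hspos : 0 < s := lt_of_le_of_ne hs0 (Ne.symm hs00)
      -- divide `h` by `s`
      have h' : s ≤ (N : ℝ) / ((N : ℝ) - 1 / N) * (frobNorm B * frobNorm M * (1 + 1 / ((N : ℝ) * ((N : ℝ) * (1 / 2 - r))))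
          + (N : ℝ) / ((N : ℝ) - 1 / N) * (2 * Real.sqrt N * r * frobNorm B) * s / N) := by
        have e : (N : ℝ) / ((N : ℝ) - 1 / N) * (frobNorm B * (s * frobNorm M) * (1 + 1 / ((N : ℝ) * ((N : ℝ) * (1 / 2 - r))))
            + (N : ℝ) / ((N : ℝ) - 1 / N) * (2 * Real.sqrt N * r * frobNorm B) * (s * s) / N) =
            s * ((N : ℝ) / ((N : ℝ) - 1 / N) * (frobNorm B * frobNorm M * (1 + 1 / ((N : ℝ) * ((N : ℝ) * (1 / 2 - r))))
              + (N : ℝ) / ((N : ℝ) - 1 / N) * (2 * Real.sqrt N * r * frobNorm B) * s / N)) := by ring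
        rw [e] at h
        exact le_of_mul_le_mul_left (by linarith [h]) hspos
      rw [← hlam, ← hD] at h' hAB
      have h2 : D * (D * (2 * Real.sqrt N * r * frobNorm B) * s / N) ≤ D * (2 * D * r ^ 2 * s) := by
        refine mul_le_mul_of_nonneg_left ?_ hD0
        have := mul_le_mul_of_nonneg_right hAB hs0
        calc D * (2 * Real.sqrt N * r * frobNorm B) * s / N = D * (2 * Real.sqrt N * r * frobNorm B) / N * s := by ring
          _ ≤ 2 * D * r ^ 2 * s := this
      have h3 : D * (frobNorm B * frobNorm M * (1 + 1 / ((N : ℝ) * ((N : ℝ) * (1 / 2 - r))))) = D * frobNorm M * Φ := by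
        rw [hΦ]; ring
      linarith [h', h2, h3]
  have hfin : s ≤ D * frobNorm M * Φ / (1 - 2 * D ^ 2 * r ^ 2) := by
    rw [le_div_iff₀ hden]; exact hkey
  calc s ≤ D * frobNorm M * Φ / (1 - 2 * D ^ 2 * r ^ 2) := hfin
    _ = _ := by rw [hΦ]; ring

/-- **Second moment of the complex linear statistic, second-order mean**:
`√(∫ ‖tr(gM)‖² dν_B) ≤ D‖B‖_F‖M‖_F(1 + 1/(Nρ))/(1 − 2D²‖B‖_op²) + ‖M‖_F/√ρ`. [folklore] -/
theorem sqrt_integral_normSq_trace_le_two (hN : 2 ≤ N) {B : Matrix (Fin N) (Fin N) ℂ} (hB : matrixOpNorm B < 1 / 2)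
    (M : Matrix (Fin N) (Fin N) ℂ) :
    Real.sqrt (∫ g, ‖((g : Matrix (Fin N) (Fin N) ℂ) * M).trace‖ ^ 2
        ∂(haarProbability (SUN N)).tilted (fun g => (N : ℝ) * ((g : Matrix (Fin N) (Fin N) ℂ) * B).trace.re)) ≤
      (N : ℝ) / ((N : ℝ) - 1 / N) * frobNorm B * frobNorm M * (1 + 1 / ((N : ℝ) * ((N : ℝ) * (1 / 2 - matrixOpNorm B))))
          / (1 - 2 * ((N : ℝ) / ((N : ℝ) - 1 / N)) ^ 2 * matrixOpNorm B ^ 2)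
        + frobNorm M / Real.sqrt ((N : ℝ) * (1 / 2 - matrixOpNorm B)) := by
  have hN0 : N ≠ 0 := by omega
  have hNpos : (0 : ℝ) < N := Nat.cast_pos.2 (Nat.pos_of_ne_zero hN0)
  have hK : 0 < (N : ℝ) * (1 / 2 - matrixOpNorm B) := mul_pos hNpos (by linarith)
  set ν : Measure (SUN N) :=
    (haarProbability (SUN N)).tilted (fun g => (N : ℝ) * ((g : Matrix (Fin N) (Fin N) ℂ) * B).trace.re) with hν
  have hexpi : Integrable (fun g : SUN N => Real.exp ((N : ℝ) * ((g : Matrix (Fin N) (Fin N) ℂ) * B).trace.re))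
      (haarProbability (SUN N)) :=
    integrable_of_continuous_SUN (Real.continuous_exp.comp (continuous_restrict (contDiff_pot (N : ℝ) B))) _
  haveI : IsProbabilityMeasure ν := isProbabilityMeasure_tilted hexpi
  set fr : SUN N → ℝ := fun g => ((g : Matrix (Fin N) (Fin N) ℂ) * M).trace.re with hfr
  set fi : SUN N → ℝ := fun g => ((g : Matrix (Fin N) (Fin N) ℂ) * M).trace.im with hfi
  have hfrc : Continuous fr := continuous_re_trace_su_mul M
  have hfic : Continuous fi := (continuous_restrict (N := N) (contDiff_pot 1 ((-I) • M))).congr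
    (fun g => by simp only [pot, one_mul, re_trace_mul_negI_smul, hfi])
  have mr : MemLp fr 2 ν := memLp_two_of_continuous hfrc ν
  have mi : MemLp fi 2 ν := memLp_two_of_continuous hfic ν
  have hsq : (fun g : SUN N => ‖((g : Matrix (Fin N) (Fin N) ℂ) * M).trace‖ ^ 2) = fun g => fr g ^ 2 + fi g ^ 2 := by
    funext g; rw [Complex.sq_norm, Complex.normSq_apply]; simp only [hfr, hfi]; ring
  have i1 : Integrable (fun g => fr g ^ 2) ν := integrable_of_continuous_SUN (hfrc.pow 2) ν
  have i2 : Integrable (fun g => fi g ^ 2) ν := integrable_of_continuous_SUN (hfic.pow 2) ν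
  have hvr : ∫ g, fr g ^ 2 ∂ν = Var[fr; ν] + (∫ g, fr g ∂ν) ^ 2 := by
    rw [variance_eq_sub mr]; simp
  have hvi : ∫ g, fi g ^ 2 ∂ν = Var[fi; ν] + (∫ g, fi g ∂ν) ^ 2 := by
    rw [variance_eq_sub mi]; simp
  have hvar := variance_re_add_variance_im_le hN0 hB M (N := N)
  rw [← hν] at hvar
  have hmean := norm_mean_trace_le_two hN hB M
  rw [← hν] at hmean
  set A : ℝ := (N : ℝ) / ((N : ℝ) - 1 / N) * frobNorm B * frobNorm M * (1 + 1 / ((N : ℝ) * ((N : ℝ) * (1 / 2 - matrixOpNorm B))))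
      / (1 - 2 * ((N : ℝ) / ((N : ℝ) - 1 / N)) ^ 2 * matrixOpNorm B ^ 2) with hA
  set V : ℝ := frobNorm M ^ 2 / ((N : ℝ) * (1 / 2 - matrixOpNorm B)) with hV
  have hA0 : 0 ≤ A := (Real.sqrt_nonneg _).trans hmean
  have hV0 : 0 ≤ V := by positivity
  have htot : ∫ g, ‖((g : Matrix (Fin N) (Fin N) ℂ) * M).trace‖ ^ 2 ∂ν ≤ (A + Real.sqrt V) ^ 2 := by
    rw [hsq, integral_add i1 i2, hvr, hvi]
    have hm2 : (∫ g, fr g ∂ν) ^ 2 + (∫ g, fi g ∂ν) ^ 2 ≤ A ^ 2 := by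
      have h0 : 0 ≤ (∫ g, fr g ∂ν) ^ 2 + (∫ g, fi g ∂ν) ^ 2 := by positivity
      calc (∫ g, fr g ∂ν) ^ 2 + (∫ g, fi g ∂ν) ^ 2 = Real.sqrt ((∫ g, fr g ∂ν) ^ 2 + (∫ g, fi g ∂ν) ^ 2) ^ 2 :=
            (Real.sq_sqrt h0).symm
        _ ≤ A ^ 2 := pow_le_pow_left₀ (Real.sqrt_nonneg _) hmean 2
    have hsV : Real.sqrt V ^ 2 = V := Real.sq_sqrt hV0
    nlinarith [hvar, hm2, hsV, mul_nonneg hA0 (Real.sqrt_nonneg V)]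
  have hsqrtV : Real.sqrt V = frobNorm M / Real.sqrt ((N : ℝ) * (1 / 2 - matrixOpNorm B)) := by
    rw [hV, Real.sqrt_div' _ hK.le, Real.sqrt_sq (frobNorm_nonneg M)]
  calc Real.sqrt (∫ g, ‖((g : Matrix (Fin N) (Fin N) ℂ) * M).trace‖ ^ 2 ∂ν) ≤ Real.sqrt ((A + Real.sqrt V) ^ 2) :=
        Real.sqrt_le_sqrt htot
    _ = A + Real.sqrt V := Real.sqrt_sq (add_nonneg hA0 (Real.sqrt_nonneg _))
    _ = _ := by rw [hsqrtV]

end Summit.Ventures.YMGap.OneLinkEigen
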